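import Summits.AtomisticToContinuum.BoseEinsteinCondensation.Theorems.BECCutLineWeakDisorderTwoReplicaTransienceBoundInsertionStep
import Summits.AtomisticToContinuum.BoseEinsteinCondensation.Theorems.BECCutLineWeakDisorderTwoReplicaTransienceBoundSurvivalFloor
import Summits.AtomisticToContinuum.BoseEinsteinCondensation.Theorems.BECCutLineWeakDisorderTwoReplicaTransienceBoundRecursion
import Summits.AtomisticToContinuum.BoseEinsteinCondensation.Theorems.BECCutLineWeakDisorderTwoReplicaTransienceBoundSausageMoment
import Summits.AtomisticToContinuum.BoseEinsteinCondensation.Theorems.BECCutLineWeakDisorderTwoReplicaTransienceBoundSliceBound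
import Literature.MathematicalPhysics.QuantumManyBody.BoseGasThermodynamicLimitRuelle
import HarnessLib

/-!
# Crux `TwoReplicaTransienceBound` (stmt-AtomisticToContinuum-9687), line `SketchIdeator1` v6:
# the SHORT-TIME WINDOW of the crux (stub `stub_shortTime`)

Support file (`--supports stmt-AtomisticToContinuum-9687`, lead c3). **The crux holds on every bounded window of
polymer lengths, uniformly in the particle number, for EVERY admissible pair potential (hard cores included),
with the absolute constant `20`:**

`∀ v admissible, ∀ T₀ > 0, ∃ ρ₁ > 0, ∀ ρ ∈ (0, ρ₁), ∀ᶠ n, ∀ T ∈ [0, T₀]: ∫ L³ m_T(Y)²/s_T(Y)² dY ≤ 20`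

(`Ψ_T = fkWitness v L T 1`, `L = sideLength ρ (n+1)`). So the threshold `1 ≤ T` of the crux is immaterial: given
this file the crux is EQUIVALENT to its restriction to `T ≥ T₀` for any fixed `T₀` (`stub_longTime`), and the
open content is pinned to the approach to the ground state. Assembly of the v6 stubs:

* slice bound `Z_{n+1}(x::Y) ≤ Z_n(Y)` (factorisation through the tracer, `tracer ≤ 1`), whence the crux
  integral is `≤ L³ N_n / N_{n+1}`, `N_k = ‖e^{-TH_k}1‖₂²` at the SAME box (`lintegral_ratio_le`);
* the insertion step `Θ N_{k+1} ≤ N_{k+2} + (k+1)|Λ| K_T N_k` (`stub_insertionStep`) with the cubic sausage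
  moment `K_T ≤ K(R, T₀)` (`stub_sausageMoment`), fed to the recursion `stub_recursion` with `A = n|Λ|K`,
  base `N_1 = Θ`, `N_0 ≤ 1`, and smallness `4A ≤ Θ²` from the survival floor `Θ ≥ q₀ (L/2)³`
  (`stub_survivalFloor`, valid once `L² ≥ 1920 T₀`, i.e. eventually in `n`) and `ρ < q₀²/(256 (K+1))`;
* conclusion `Θ N_n ≤ 2 N_{n+1}` ⇒ integral `≤ 2L³/Θ ≤ 16/q₀ ≤ 20` (`e⁵ ≥ 32`).

Physically: at density `ρ` the window covers `T ≲ ρ^{-2/3}` (the time to diffuse the interparticle distance);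
for bounded `v` the tangent step `stub_insertionStepBounded` stretches it to the chemical-potential time
`T ≲ 1/(ρ‖v‖₁)`. Beyond, insertion costs `e^{-μT}` and the slice bound is no longer affordable: that is the open stub.
-/

noncomputable section

open MeasureTheory Filter Set
open scoped ENNReal NNReal Topology BigOperators



namespace Summit.AtomisticToContinuum.BoseEinsteinCondensation.Cruxes.TwoReplicaTransienceBound.TracerDecoupling

open Literature.MathematicalPhysics.QuantumManyBody.BoseGas
open Literature.Probability.Process (runSup)
open Summit.AtomisticToContinuum.BoseEinsteinCondensation.Theorems.CutLineWitness
open Summit.AtomisticToContinuum.BoseEinsteinCondensation.Cruxes.TwoReplicaTransienceBound.ShortTime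

/-- **Registered stub `stub_shortTime`** (crux stmt-AtomisticToContinuum-9687, line `SketchIdeator1` v6): **the
crux on every bounded window of polymer lengths, uniformly in `n`, for every admissible `v`, with the absolute
constant `20`.** Given `v` (range `R₀`) and `T₀`: `R = max R₀ 0`, `K` from `stub_sausageMoment R T₀`,
`ρ₁ = q₀²/(256 (K+1))`; for `ρ < ρ₁`, eventually `L = sideLength ρ (n+1) ≥ √(1920 T₀)`; then for `T ∈ [0,T₀]` the
recursion `stub_recursion` (steps `stub_insertionStep`, base `N_1 = Θ`, `N_0 ≤ 1`, smallness from
`stub_survivalFloor`) gives `Θ N_n ≤ 2N_{n+1}`, and the slice reduction `lintegral_ratio_le` gives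
`∫L³m²/s² ≤ 2L³/Θ ≤ 16/q₀ ≤ 20`. -/
theorem stub_shortTime :
    ∀ (v : ℝ → ENNReal), IsRepulsiveFiniteRange v → ∀ T₀ : ℝ, 0 < T₀ → ∃ ρ₁ : ℝ, 0 < ρ₁ ∧
      ∀ ρ : ℝ, 0 < ρ → ρ < ρ₁ → ∀ᶠ n : ℕ in Filter.atTop, ∀ T : ℝ, 0 ≤ T → T ≤ T₀ →
        ∫⁻ Y : Config n, ENNReal.ofReal (sideLength ρ (n + 1) ^ 3) *
            (∫⁻ x, (‖@fkWitness (n + 1) v (sideLength ρ (n + 1)) T (fun _ => (1 : ENNReal))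
              (Matrix.vecCons x Y)‖₊ : ENNReal) ^ 2) ^ 2 /
            (∫⁻ x, (‖@fkWitness (n + 1) v (sideLength ρ (n + 1)) T (fun _ => (1 : ENNReal))
              (Matrix.vecCons x Y)‖₊ : ENNReal)) ^ 2 ≤ ENNReal.ofReal 20 := by
  intro v hv T₀ hT₀
  obtain ⟨hvm, R₀, hR₀⟩ := hv
  -- the range, made nonnegative
  set R : ℝ := max R₀ 0 with hRdef
  have hR : 0 ≤ R := le_max_right _ _
  have hvR : ∀ r, R < r → v r = 0 := fun r hr => hR₀ r (lt_of_le_of_lt (le_max_left _ _) hr)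
  -- the sausage constant on the window `[0, T₀]`
  obtain ⟨K, hKtop, hK⟩ := stub_sausageMoment R hR T₀
  set q₀ : ℝ := 1 - 6 * Real.exp (-5) with hq₀def
  have hq₀ : 0 < q₀ := FreeGas.q0_pos
  set Kr : ℝ := K.toReal with hKrdef
  have hKr : 0 ≤ Kr := ENNReal.toReal_nonneg
  have hKeq : K = ENNReal.ofReal Kr := (ENNReal.ofReal_toReal hKtop).symm
  refine ⟨q₀ ^ 2 / (256 * (Kr + 1)), by positivity, fun ρ hρ hρ₁ => ?_⟩
  -- eventually in `n`: the box is large, `L ≥ L₀ = √(1920 T₀)`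
  set L₀ : ℝ := Real.sqrt (1920 * T₀) with hL₀def
  have hL₀ : 0 ≤ L₀ := Real.sqrt_nonneg _
  have hev : ∀ᶠ n : ℕ in Filter.atTop, L₀ ≤ sideLength ρ (n + 1) :=
    ((tendsto_sideLength_atTop hρ).comp (tendsto_add_atTop_nat 1)).eventually_ge_atTop L₀
  filter_upwards [hev] with n hn T hT hTT₀
  set L : ℝ := sideLength ρ (n + 1) with hLdef
  have hL : 0 < L := Real.rpow_pos_of_pos (div_pos (by exact_mod_cast Nat.succ_pos n) hρ) _
  have hL3 : L ^ 3 = ((n + 1 : ℕ) : ℝ) / ρ := sideLength_pow_three hρ (n + 1)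
  -- the window condition `2T ≤ L²/960`
  have h2T : 2 * T ≤ L ^ 2 / 960 := by
    have h1 : L₀ ^ 2 ≤ L ^ 2 := pow_le_pow_left₀ hL₀ hn 2
    rw [hL₀def, Real.sq_sqrt (by positivity)] at h1
    linarith
  /- ### the partition norms at this box and time -/
  set N : ℕ → ℝ≥0∞ := fun k => fkNormSq (N := k) v L T (fun _ => (1 : ℝ≥0∞)) with hNdef
  set Θ : ℝ≥0∞ := fkNormSq (N := 1) (fun _ => 0) L T (fun _ => (1 : ℝ≥0∞)) with hΘdef
  have hNtop : ∀ k, N k ≠ ⊤ := fun k =>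
    Summit.AtomisticToContinuum.BoseEinsteinCondensation.Theorems.TwoReplicaTransienceBound.Negative.fkNormSq_one_ne_top
      (N := k) v L hT
  have hΘtop : Θ ≠ ⊤ :=
    Summit.AtomisticToContinuum.BoseEinsteinCondensation.Theorems.TwoReplicaTransienceBound.Negative.fkNormSq_one_ne_top
      (N := 1) (fun _ => 0) L hT
  -- survival floor
  set θ₀ : ℝ≥0∞ := ENNReal.ofReal (q₀ * (L / 2) ^ 3) with hθ₀def
  have hθ₀Θ : θ₀ ≤ Θ := stub_survivalFloor L T hL hT h2T
  have hθ₀pos : θ₀ ≠ 0 := by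
    rw [hθ₀def]; exact (ENNReal.ofReal_pos.2 (by positivity)).ne'
  have hθ₀top : θ₀ ≠ ⊤ := ENNReal.ofReal_ne_top
  -- the error coefficient `A = n · |Λ| · K`
  set A : ℝ≥0∞ := (n : ℝ≥0∞) * (ENNReal.ofReal (L ^ 3) * K) with hAdef
  -- base of the recursion: `Θ N₀ ≤ N₁ = Θ`
  have hbase : Θ * N 0 ≤ N 1 := by
    calc Θ * N 0 ≤ Θ * 1 := mul_le_mul' le_rfl (fkNormSq_zero_particle_le v L T)
      _ = N 1 := by rw [mul_one, hNdef]; exact (fkNormSq_one_particle v L T).symm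
  -- steps of the recursion (the insertion step with the sausage moment bounded by `K`)
  have hsteps : ∀ k, k + 2 ≤ n + 1 → Θ * N (k + 1) ≤ N (k + 2) + A * N k := by
    intro k hk
    have hins := stub_insertionStep k v hvm R hR hvR L T hL hT
    refine hins.trans (add_le_add le_rfl (mul_le_mul' ?_ le_rfl))
    have hk' : ((k : ℝ≥0∞) + 1) ≤ (n : ℝ≥0∞) := by exact_mod_cast (by omega : k + 1 ≤ n)
    calc ((k : ℝ≥0∞) + 1) * ENNReal.ofReal (L ^ 3) *
          (∫⁻ ω₀, ∫⁻ ω, ENNReal.ofReal ((2 * (R + Real.sqrt 2 *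
            ((∑ k, runSup (2 * T).toNNReal (ω₀ k)) + ∑ k, runSup (2 * T).toNNReal (ω k)))) ^ 3)
              ∂wienerLine ∂wienerLine)
        ≤ (n : ℝ≥0∞) * ENNReal.ofReal (L ^ 3) * K := mul_le_mul' (mul_le_mul' hk' le_rfl) (hK T hTT₀)
      _ = A := by rw [hAdef, mul_assoc]
  -- smallness `4A ≤ Θ²` from `ρ < q₀²/(256 (K+1))`
  have hsmall : 4 * A ≤ Θ ^ 2 := by
    have hreal : 4 * ((n : ℝ) * (L ^ 3 * Kr)) ≤ (q₀ * (L / 2) ^ 3) ^ 2 := by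
      -- `256 n Kr ρ ≤ q₀² (n+1)`, using `L³ = (n+1)/ρ`
      have hn0 : (0 : ℝ) ≤ n := Nat.cast_nonneg n
      have h1 : ρ * (256 * (Kr + 1)) ≤ q₀ ^ 2 := by
        have := hρ₁.le
        rwa [le_div_iff₀ (by positivity)] at this
      have h2 : 256 * (n : ℝ) * Kr * ρ ≤ q₀ ^ 2 * ((n : ℝ) + 1) := by
        nlinarith [mul_nonneg hn0 hKr, mul_nonneg hn0 hρ.le, sq_nonneg q₀, mul_nonneg (mul_nonneg hn0 hKr) hρ.le]
      have h3 : (q₀ * (L / 2) ^ 3) ^ 2 = q₀ ^ 2 * (L ^ 3) ^ 2 / 64 := by ring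
      rw [h3, hL3, Nat.cast_succ]
      rw [le_div_iff₀ (by norm_num : (0 : ℝ) < 64)]
      have hρne : ρ ≠ 0 := hρ.ne'
      field_simp
      nlinarith [h2, hn0, hKr, hρ.le]
    calc 4 * A = ENNReal.ofReal (4 * ((n : ℝ) * (L ^ 3 * Kr))) := by
          rw [hAdef, hKeq, ENNReal.ofReal_mul (by norm_num), ENNReal.ofReal_mul (Nat.cast_nonneg n),
            ENNReal.ofReal_mul (by positivity), ENNReal.ofReal_natCast, ENNReal.ofReal_ofNat]
      _ ≤ ENNReal.ofReal ((q₀ * (L / 2) ^ 3) ^ 2) := ENNReal.ofReal_le_ofReal hreal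
      _ = θ₀ ^ 2 := by rw [hθ₀def, ENNReal.ofReal_pow (by positivity)]
      _ ≤ Θ ^ 2 := pow_le_pow_left' hθ₀Θ 2
  -- the recursion
  have hrec : Θ * N n ≤ 2 * N (n + 1) := stub_recursion N Θ A (n + 1) hΘtop hNtop hbase hsteps hsmall n le_rfl
  /- ### the crux integral: normalisation bookkeeping and the slice reduction -/
  set 𝒩 : ℝ≥0∞ := fkNormSq (N := n + 1) v L T (fun _ => (1 : ℝ≥0∞)) with h𝒩
  set c : ℝ := (Real.sqrt 𝒩.toReal)⁻¹ with hc
  have hΨ : ∀ X, fkWitness (N := n + 1) v L T (fun _ => (1 : ℝ≥0∞)) X = c * (fkPartition v L T X).toReal :=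
    fun X => fkWitness_one_eq v L T X
  by_cases hc0 : c = 0
  · have h0 : ∀ X, fkWitness (N := n + 1) v L T (fun _ => (1 : ℝ≥0∞)) X = 0 := fun X => by
      rw [hΨ X, hc0, zero_mul]
    simp [h0]
  have hsqrt : Real.sqrt 𝒩.toReal ≠ 0 := fun h => hc0 (by rw [hc, h, inv_zero])
  have htR : 0 < 𝒩.toReal := not_le.1 fun h => hsqrt (Real.sqrt_eq_zero'.2 h)
  have h𝒩0 : 𝒩 ≠ 0 := fun h => htR.ne' (by rw [h, ENNReal.toReal_zero])
  have h𝒩top : 𝒩 ≠ ⊤ := fun h => htR.ne' (by rw [h, ENNReal.toReal_top])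
  have hc𝒩 : ENNReal.ofReal (c ^ 2) * 𝒩 = 1 := by
    have hc2 : c ^ 2 = (𝒩.toReal)⁻¹ := by rw [hc, inv_pow, Real.sq_sqrt htR.le]
    rw [hc2, ENNReal.ofReal_inv_of_pos htR, ENNReal.ofReal_toReal h𝒩top, ENNReal.inv_mul_cancel h𝒩0 h𝒩top]
  have hnn : ∀ X : Config (n + 1), (‖(fkPartition v L T X).toReal‖₊ : ℝ≥0∞) = fkPartition v L T X :=
    fun X => coe_nnnorm_toReal (fkPartition_ne_top v L T X)
  simp_rw [hΨ]
  rw [lintegral_ratio_const_mul L (fun X => (fkPartition v L T X).toReal) hc0]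
  simp_rw [hnn]
  -- `I ≤ c² · L³ · N_n`, and `Θ · (c² L³ N_n) ≤ c² L³ · 2 N_{n+1} = 2 L³`
  set I : ℝ≥0∞ := ENNReal.ofReal (c ^ 2) * ∫⁻ Y : Config n, ENNReal.ofReal (L ^ 3) *
      (∫⁻ x, fkPartition v L T (Matrix.vecCons x Y) ^ 2) ^ 2 /
        (∫⁻ x, fkPartition v L T (Matrix.vecCons x Y)) ^ 2 with hI
  have hI1 : I ≤ ENNReal.ofReal (c ^ 2) * (ENNReal.ofReal (L ^ 3) * N n) :=
    mul_le_mul' le_rfl (lintegral_ratio_le hvm L T)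
  have hI2 : Θ * I ≤ 2 * ENNReal.ofReal (L ^ 3) := by
    calc Θ * I ≤ Θ * (ENNReal.ofReal (c ^ 2) * (ENNReal.ofReal (L ^ 3) * N n)) := mul_le_mul' le_rfl hI1
      _ = ENNReal.ofReal (c ^ 2) * ENNReal.ofReal (L ^ 3) * (Θ * N n) := by ring
      _ ≤ ENNReal.ofReal (c ^ 2) * ENNReal.ofReal (L ^ 3) * (2 * N (n + 1)) := mul_le_mul' le_rfl hrec
      _ = 2 * ENNReal.ofReal (L ^ 3) * (ENNReal.ofReal (c ^ 2) * 𝒩) := by rw [hNdef]; ring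
      _ = 2 * ENNReal.ofReal (L ^ 3) := by rw [hc𝒩, mul_one]
  -- divide by the survival floor
  have hI3 : I ≤ 2 * ENNReal.ofReal (L ^ 3) / θ₀ := by
    rw [ENNReal.le_div_iff_mul_le (Or.inl hθ₀pos) (Or.inl hθ₀top)]
    calc I * θ₀ = θ₀ * I := mul_comm _ _
      _ ≤ Θ * I := mul_le_mul' hθ₀Θ le_rfl
      _ ≤ 2 * ENNReal.ofReal (L ^ 3) := hI2
  refine hI3.trans ?_
  -- `2 L³ / (q₀ (L/2)³) = 16/q₀ ≤ 20`
  have hL3pos : 0 < L ^ 3 := by positivity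
  rw [hθ₀def, ← ENNReal.ofReal_ofNat 2, ← ENNReal.ofReal_mul (by norm_num),
    ← ENNReal.ofReal_div_of_pos (by positivity)]
  refine ENNReal.ofReal_le_ofReal ?_
  rw [div_le_iff₀ (by positivity)]
  have h16 := sixteen_le_twenty_mul_q0
  nlinarith [hL3pos, h16, hq₀]

/-- **The threshold `1 ≤ T` of the crux is immaterial**: `TwoReplicaTransienceBound` is EQUIVALENT to its
restriction to polymer lengths `T ≥ T₀` for SOME fixed `T₀ > 0` (the v6 open stub `stub_longTime`) — forward with
`T₀ = 1`; backward by covering `[1, T₀]` with the short-time window `stub_shortTime` (shrink `ρ₀`, max the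
constants). The open content of the crux is thus the approach to the ground state only. -/
theorem twoReplicaTransienceBound_iff_longTime :
    Summit.AtomisticToContinuum.BoseEinsteinCondensation.Theses.BECCutLineWeakDisorder.TwoReplicaTransienceBound ↔
      ∀ (v : ℝ → ENNReal), IsRepulsiveFiniteRange v → ∃ T₀ : ℝ, 0 < T₀ ∧ ∃ ρ₀ : ℝ, 0 < ρ₀ ∧
        ∀ ρ : ℝ, 0 < ρ → ρ < ρ₀ → ∃ C : ℝ, 0 < C ∧ ∀ᶠ n : ℕ in Filter.atTop, ∀ T : ℝ, T₀ ≤ T →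
          ∫⁻ Y : Config n, ENNReal.ofReal (sideLength ρ (n + 1) ^ 3) *
              (∫⁻ x, (‖@fkWitness (n + 1) v (sideLength ρ (n + 1)) T (fun _ => (1 : ENNReal))
                (Matrix.vecCons x Y)‖₊ : ENNReal) ^ 2) ^ 2 /
              (∫⁻ x, (‖@fkWitness (n + 1) v (sideLength ρ (n + 1)) T (fun _ => (1 : ENNReal))
                (Matrix.vecCons x Y)‖₊ : ENNReal)) ^ 2 ≤ ENNReal.ofReal C := by
  constructor
  · intro h v hv
    obtain ⟨ρ₀, hρ₀, H⟩ := h v hv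
    exact ⟨1, one_pos, ρ₀, hρ₀, fun ρ hρ hρlt => H ρ hρ hρlt⟩
  · intro hL v hv
    obtain ⟨T₀, hT₀, ρ₀, hρ₀, HL⟩ := hL v hv
    obtain ⟨ρ₁, hρ₁, HS⟩ := stub_shortTime v hv T₀ hT₀
    refine ⟨min ρ₀ ρ₁, lt_min hρ₀ hρ₁, fun ρ hρ hρlt => ?_⟩
    obtain ⟨C, hC, evL⟩ := HL ρ hρ (hρlt.trans_le (min_le_left _ _))
    have evS := HS ρ hρ (hρlt.trans_le (min_le_right _ _))
    refine ⟨max C 20, lt_max_of_lt_left hC, ?_⟩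
    filter_upwards [evL, evS] with n hnL hnS T hT
    rcases le_total T T₀ with h | h
    · exact (hnS T (zero_le_one.trans hT) h).trans (ENNReal.ofReal_le_ofReal (le_max_right _ _))
    · exact (hnL T h).trans (ENNReal.ofReal_le_ofReal (le_max_left _ _))

/-- **The crux may equivalently be stated for ALL polymer lengths `T ≥ 0`** (not only `T ≥ 1`): forward by covering
`[0, 1]` with the short-time window `stub_shortTime` (shrink `ρ₀`, max the constant with `20`); backward trivially. Together
with `twoReplicaTransienceBound_iff_longTime`: every threshold `T ≥ T₀`, `T₀ ∈ [0, ∞)`, gives the same statement. -/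
theorem twoReplicaTransienceBound_iff_allT :
    Summit.AtomisticToContinuum.BoseEinsteinCondensation.Theses.BECCutLineWeakDisorder.TwoReplicaTransienceBound ↔
      ∀ (v : ℝ → ENNReal), IsRepulsiveFiniteRange v → ∃ ρ₀ : ℝ, 0 < ρ₀ ∧
        ∀ ρ : ℝ, 0 < ρ → ρ < ρ₀ → ∃ C : ℝ, 0 < C ∧ ∀ᶠ n : ℕ in Filter.atTop, ∀ T : ℝ, 0 ≤ T →
          ∫⁻ Y : Config n, ENNReal.ofReal (sideLength ρ (n + 1) ^ 3) *
              (∫⁻ x, (‖@fkWitness (n + 1) v (sideLength ρ (n + 1)) T (fun _ => (1 : ENNReal))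
                (Matrix.vecCons x Y)‖₊ : ENNReal) ^ 2) ^ 2 /
              (∫⁻ x, (‖@fkWitness (n + 1) v (sideLength ρ (n + 1)) T (fun _ => (1 : ENNReal))
                (Matrix.vecCons x Y)‖₊ : ENNReal)) ^ 2 ≤ ENNReal.ofReal C := by
  constructor
  · intro h v hv
    obtain ⟨ρ₀, hρ₀, H⟩ := h v hv
    obtain ⟨ρ₁, hρ₁, HS⟩ := stub_shortTime v hv 1 one_pos
    refine ⟨min ρ₀ ρ₁, lt_min hρ₀ hρ₁, fun ρ hρ hρlt => ?_⟩
    obtain ⟨C, hC, ev⟩ := H ρ hρ (hρlt.trans_le (min_le_left _ _))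
    have evS := HS ρ hρ (hρlt.trans_le (min_le_right _ _))
    refine ⟨max C 20, lt_max_of_lt_left hC, ?_⟩
    filter_upwards [ev, evS] with n hn hnS T hT
    rcases le_total T 1 with h1 | h1
    · exact (hnS T hT h1).trans (ENNReal.ofReal_le_ofReal (le_max_right _ _))
    · exact (hn T h1).trans (ENNReal.ofReal_le_ofReal (le_max_left _ _))
  · intro h v hv
    obtain ⟨ρ₀, hρ₀, H⟩ := h v hv
    refine ⟨ρ₀, hρ₀, fun ρ hρ hρlt => ?_⟩
    obtain ⟨C, hC, ev⟩ := H ρ hρ hρlt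
    refine ⟨C, hC, ?_⟩
    filter_upwards [ev] with n hn T hT
    exact hn T (zero_le_one.trans hT)

end Summit.AtomisticToContinuum.BoseEinsteinCondensation.Cruxes.TwoReplicaTransienceBound.TracerDecoupling

end
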